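import Summits.QuantumFields.BalabanUV.Beta.GAN24.SourceSideDict
import Summits.QuantumFields.BalabanUV.Beta.GAN24.SourceSideMajorant

/-!
# `BalabanUV.Beta.GAN24.SourceSideBound` — binder row G-an2-4 / (CONV-C), road P1-fibre, sub-part **PART S** of gan24-p1's row
# **P1-L11** `FibreRate` (leaf-20-g7's division, CLAIMS l.3039; TAKE l.3074) — PART 3: `N`-UNIFORM BOUNDS of the source-side sums
# `S_φ`, `S_c` in units `N³`, with the zero-alias pole DISPLAYED (`|q|⁻²` resp. `|q|⁻³`) and the nonzero-alias share `p`-free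

NOT IN PRINT; OUR PROOF ATTEMPT.  HONEST FRAMING (cell contract, verbatim): «discharging `BetaPertH` makes Bałaban's UV stability
UNCONDITIONAL — a real constructive-QFT result; it is NOT the continuum limit and NOT the Clay problem.»  HONEST DEPENDENCY (verbatim):
«continuum YM on T⁴ ⇐ BetaPertH ∧ nine spine estimates (0/9 proved); BetaPertH ⇐ (D1) ∧ (D4) ∧ CAP+tail; G-an2-4 gates asym, D1 and
NE2/3/4.»  [folklore] explicit real analysis (finite alias sums); 0 cite, 0 wall binder, no `def … : Prop`, no new `def` at all (constants
displayed inline).  It discharges NOTHING of (CONV-C)'s K-slot `GAN24.CombesThomas.ConvCK 3 Lc` by itself.  NOT `BetaPertH`, NOT continuum,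
NOT Clay.  Value = kernel bookkeeping toward the K-slot route P1 of binder row G-an2-4, NOT summit progress.

## What is proved (`q ∈ [−π, π]^D ∖ {0}`, `p = ofRealVec q`, `N = M·Lc`, `|q|² = momSq q`; the shapes leaf-20-g7 asked for in CLAIMS l.3039,
## unit `u(N) = N⁻³` for both sums)
* per-label majorants (§1): `‖termC (q + 2πz)‖ ≤ [z = 0]·(π⁴/16)/(|q|²·|q|) + (Lc/8)·Π_i mP Lc z_i` and
  `‖termPhi (q + 2πz)‖ ≤ [z = 0]·(π²/8 + π⁴/32)/|q|² + ((1 + Lc)/8)·Π_i mP Lc z_i` — the zero alias carries the pole, every other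
  alias is `p`-free (`|Q|² ≥ π²`, leaf P1-Y11s `pi_sq_le_momSq_qv`; `1/symN ≤ (π²/4)/|Q|²`, `symN_inv_bounds`);
* **`norm_srcC_fhatF_le`**: `‖srcC N p (fhatF N M p l y′)‖ ≤ N³ · ((π⁴/16)/(|q|²·|q|) + (Lc/8)·(1 + 4Lc)^D)`;
* **`norm_srcPhi_fhatF_le`**: `‖srcPhi N p (fhatF N M p l y′) 0 l′‖ ≤ N³ · ((π²/8 + π⁴/32)/|q|² + ((1 + Lc)/8)·(1 + 4Lc)^D)`,
  via part 2's alias-box forms and part 1b's `sum_boxZ_prod_mP_le`.  Orders as announced in l.3028/l.3039 («m = 0 term N³/|q|²-order»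
  for `srcPhi`, `N³/|q|³` for `srcC`).
The two-level RATES are parts 4–6 (`SourceSideRate`: `S_c`; `SourceSideRatePhi` + `SourceSideRatePhiSum`: `S_φ`, `p`-uniform).

Unit `b2b-balaban-gan24-formalise-leaf-07` (G-an2-4 formalisation swarm, leaf prover 07, gen 6), 2026-08-20.
-/

noncomputable section

open Complex Finset
open scoped BigOperators Real

namespace Summit.QuantumFields.BalabanUV.Beta.GAN24.SourceSideBound

open Literature.Probability.LatticeModels (TorusSite)
open Literature.MathematicalPhysics.QuantumFieldTheory.Balaban1983to89.B4Strip (ofRealVec)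
open Literature.MathematicalPhysics.QuantumFieldTheory.King1986 (momSq momSq_nonneg)
open FibreSymbols (dhat dflat lapSym)
open CapacitanceScalarRate CapacitanceScalarRateTerm CapacitanceScalarRateBox CapacitanceScalarRateSum
open SourceSidePair SourceSideMajorant SourceSideDict
open AliasObjects (srcPhi srcC fhatF)

variable {D : ℕ}

/-! ## §0 Small real-analysis helpers -/

/-- [folklore] `qv q 0 = q`. -/
theorem qv_zero (q : Fin D → ℝ) : qv q (0 : Fin D → ℤ) = q := funext fun i => by simp [qv]

/-- [folklore] `Π_i mP Lc 0_i = 1`. -/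
theorem prod_mP_zero (Lc : ℕ) : ∏ i : Fin D, mP Lc ((0 : Fin D → ℤ) i) = 1 := by simp

/-- [folklore] The scaled inverse symbol at a zone label: `(symN N Q)⁻¹ ≤ (π²/4)·|Q|⁻²` and `0 < symN N Q` (`Q = q + 2πz`, `z ∈ boxZ N q`). -/
theorem symN_label_bounds {N : ℕ} [NeZero N] {q : Fin D → ℝ} (hq : ∀ i, |q i| ≤ π) (hq0 : q ≠ 0) {z : Fin D → ℤ}
    (hz : z ∈ boxZ N q) : 0 < symN N (qv q z) ∧ (symN N (qv q z))⁻¹ ≤ π ^ 2 / 4 * (momSq (qv q z))⁻¹ := by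
  have hN : 0 < N := Nat.pos_of_ne_zero (NeZero.ne N)
  have hQ : ∀ i, |qv q z i| ≤ π * N := abs_qv_le_of_mem_boxZ hq hz
  have hpos : 0 < momSq (qv q z) := momSq_qv_pos hq hq0 z
  obtain ⟨h1, h2, -⟩ := symN_inv_bounds hN hQ hpos
  have hS : 0 < (symN N (qv q z))⁻¹ := lt_of_lt_of_le (inv_pos.2 hpos) h1
  exact ⟨inv_pos.1 hS, h2⟩

/-- [folklore] Off the zero alias the scaled inverse symbol is `p`-free: `(symN N Q)⁻¹ ≤ 1/4` (`|Q|² ≥ π²`). -/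
theorem inv_symN_le_quarter {N : ℕ} [NeZero N] {q : Fin D → ℝ} (hq : ∀ i, |q i| ≤ π) (hq0 : q ≠ 0) {z : Fin D → ℤ}
    (hz : z ∈ boxZ N q) (hz0 : z ≠ 0) : (symN N (qv q z))⁻¹ ≤ 1 / 4 := by
  obtain ⟨-, h2⟩ := symN_label_bounds hq hq0 hz
  have hbig := pi_sq_le_momSq_qv hq hz0
  have hπ := Real.pi_pos
  have hm : (momSq (qv q z))⁻¹ ≤ (π ^ 2)⁻¹ := inv_anti₀ (by positivity) hbig
  calc (symN N (qv q z))⁻¹ ≤ π ^ 2 / 4 * (momSq (qv q z))⁻¹ := h2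
    _ ≤ π ^ 2 / 4 * (π ^ 2)⁻¹ := mul_le_mul_of_nonneg_left hm (by positivity)
    _ = 1 / 4 := by field_simp

/-! ## §1 Per-label majorants of the two label models -/

section Labels

variable {N M Lc : ℕ} [NeZero N] [NeZero M] [NeZero Lc]

omit [NeZero N] [NeZero M] [NeZero Lc] in
/-- [folklore] The norm of the `S_c` label model. -/
theorem norm_termC_eq (l : Fin D) (y' : Fin D → ℤ) {Q : Fin D → ℝ} (hS : 0 < symN N Q) :
    ‖termC N M Lc l y' Q‖ = (Lc : ℝ) * ‖∏ i, pairP N M (Q i)‖ * ‖eM Lc (Q l)‖ * (symN N Q)⁻¹ ^ 2 := by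
  unfold termC
  rw [norm_neg, norm_div, norm_mul, norm_mul, norm_mul, norm_srcPh, Complex.norm_natCast, norm_pow, Complex.norm_real,
    Real.norm_eq_abs, abs_of_pos hS, div_eq_mul_inv, inv_pow]
  ring

/-- [folklore] **`S_c` LABEL MAJORANT**: at `Q = q + 2πz`, `z ∈ boxZ N q`,
`‖termC‖ ≤ [z = 0]·(π⁴/16)/(|q|²·|q|) + (Lc/8)·Π_i mP Lc z_i`. -/
theorem norm_termC_le (hNM : N = M * Lc) {q : Fin D → ℝ} (hq : ∀ i, |q i| ≤ π) (hq0 : q ≠ 0) (l : Fin D) (y' : Fin D → ℤ)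
    {z : Fin D → ℤ} (hz : z ∈ boxZ N q) :
    ‖termC N M Lc l y' (qv q z)‖
      ≤ (if z = 0 then π ^ 4 / 16 / (momSq q * Real.sqrt (momSq q)) else 0) + (Lc : ℝ) / 8 * ∏ i, mP Lc (z i) := by
  have hN : 0 < N := Nat.pos_of_ne_zero (NeZero.ne N)
  have hM : 0 < M := Nat.pos_of_ne_zero (NeZero.ne M)
  have hLc : 0 < Lc := Nat.pos_of_ne_zero (NeZero.ne Lc)
  have hLcr : (0 : ℝ) < Lc := by exact_mod_cast hLc
  have hNMr : (N : ℝ) = M * Lc := by exact_mod_cast hNM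
  have hπ := Real.pi_pos
  have hQ : ∀ i, |qv q z i| ≤ π * N := abs_qv_le_of_mem_boxZ hq hz
  obtain ⟨hS, hSinv⟩ := symN_label_bounds hq hq0 hz
  have hmQ : 0 < momSq (qv q z) := momSq_qv_pos hq hq0 z
  have hP : ‖∏ i, pairP N M (qv q z i)‖ ≤ ∏ i, mP Lc (z i) := norm_prod_pairP_le hN hM hLc hNMr hq hQ
  have hPm := prod_mP_nonneg Lc z
  rw [norm_termC_eq l y' hS]
  by_cases hz0 : z = 0
  · subst hz0
    rw [if_pos rfl]
    have hq' : qv q (0 : Fin D → ℤ) = q := qv_zero q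
    rw [hq'] at hSinv hS hmQ hP ⊢
    rw [prod_mP_zero] at hP ⊢
    have hm := hmQ
    have hsq : 0 < Real.sqrt (momSq q) := Real.sqrt_pos.2 hm
    have hE : ‖eM Lc (q l)‖ ≤ Real.sqrt (momSq q) / Lc :=
      (norm_eM_le_abs hLc (q l)).trans (div_le_div_of_nonneg_right (SymbolProjector.abs_apply_le_sqrt_momSq q l) hLcr.le)
    have hinv2 : (symN N q)⁻¹ ^ 2 ≤ (π ^ 2 / 4 * (momSq q)⁻¹) ^ 2 := pow_le_pow_left₀ (inv_nonneg.2 hS.le) hSinv 2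
    have hmain : (Lc : ℝ) * ‖∏ i, pairP N M (q i)‖ * ‖eM Lc (q l)‖ * (symN N q)⁻¹ ^ 2
        ≤ π ^ 4 / 16 / (momSq q * Real.sqrt (momSq q)) := by
      calc (Lc : ℝ) * ‖∏ i, pairP N M (q i)‖ * ‖eM Lc (q l)‖ * (symN N q)⁻¹ ^ 2
          ≤ (Lc : ℝ) * 1 * (Real.sqrt (momSq q) / Lc) * (π ^ 2 / 4 * (momSq q)⁻¹) ^ 2 := by
            gcongr
        _ = π ^ 4 / 16 * (Real.sqrt (momSq q) / momSq q ^ 2) := by field_simp; ring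
        _ = π ^ 4 / 16 / (momSq q * Real.sqrt (momSq q)) := by
            -- `√m/m² = 1/(m·√m)` (the landed `T4TwoLoopLaw.sqrt_div_sq_eq`, inlined to keep the import list local)
            have e : Real.sqrt (momSq q) / momSq q ^ 2 = 1 / (momSq q * Real.sqrt (momSq q)) := by
              rw [div_eq_div_iff (by positivity) (by positivity)]
              calc Real.sqrt (momSq q) * (momSq q * Real.sqrt (momSq q))
                  = momSq q * (Real.sqrt (momSq q) * Real.sqrt (momSq q)) := by ring
                _ = 1 * momSq q ^ 2 := by rw [Real.mul_self_sqrt hm.le]; ring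
            rw [e]; field_simp
    have : 0 ≤ (Lc : ℝ) / 8 * 1 := by positivity
    linarith
  · rw [if_neg hz0, zero_add]
    have hE : ‖eM Lc (qv q z l)‖ ≤ 2 := norm_eM_le_two Lc _
    have hq4 : (symN N (qv q z))⁻¹ ≤ 1 / 4 := inv_symN_le_quarter hq hq0 hz hz0
    have hinv2 : (symN N (qv q z))⁻¹ ^ 2 ≤ (1 / 4) ^ 2 := pow_le_pow_left₀ (inv_nonneg.2 hS.le) hq4 2
    calc (Lc : ℝ) * ‖∏ i, pairP N M (qv q z i)‖ * ‖eM Lc (qv q z l)‖ * (symN N (qv q z))⁻¹ ^ 2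
        ≤ (Lc : ℝ) * (∏ i, mP Lc (z i)) * 2 * (1 / 4) ^ 2 := by gcongr
      _ = (Lc : ℝ) / 8 * ∏ i, mP Lc (z i) := by ring

omit [NeZero N] [NeZero M] [NeZero Lc] in
/-- [folklore] The norm of the `S_φ` label model is at most `‖Π pairP‖ · (‖δ-part‖ + ‖projector part‖)`. -/
theorem norm_termPhi_le_parts (q : Fin D → ℝ) (l' l : Fin D) (y' : Fin D → ℤ) {Q : Fin D → ℝ} (hS : 0 < symN N Q) :
    ‖termPhi N M Lc q l' l y' Q‖ ≤ ‖∏ i, pairP N M (Q i)‖ *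
      (‖pairP N M (Q l)‖ * (symN N Q)⁻¹ / 2 + (Lc : ℝ) * ‖dhat (ofRealVec q) l'‖ * ‖eM Lc (Q l)‖ * (symN N Q)⁻¹ ^ 2 / 2) := by
  unfold termPhi
  rw [norm_neg, norm_mul, norm_mul, norm_srcPh, one_mul]
  refine mul_le_mul_of_nonneg_left ((norm_sub_le _ _).trans (add_le_add ?_ (le_of_eq ?_))) (norm_nonneg _)
  · split_ifs with h
    · rw [norm_div, norm_mul, Complex.norm_two, Complex.norm_real, Real.norm_eq_abs, abs_of_pos hS]
      apply le_of_eq; field_simp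
    · rw [norm_zero]; positivity
  · rw [norm_div, norm_mul, norm_mul, norm_mul, Complex.norm_natCast, Complex.norm_two, norm_pow, Complex.norm_real,
      Real.norm_eq_abs, abs_of_pos hS]
    field_simp

/-- [folklore] **`S_φ` LABEL MAJORANT**: at `Q = q + 2πz`, `z ∈ boxZ N q`,
`‖termPhi‖ ≤ [z = 0]·(π²/8 + π⁴/32)/|q|² + ((1 + Lc)/8)·Π_i mP Lc z_i`. -/
theorem norm_termPhi_le (hNM : N = M * Lc) {q : Fin D → ℝ} (hq : ∀ i, |q i| ≤ π) (hq0 : q ≠ 0) (l' l : Fin D) (y' : Fin D → ℤ)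
    {z : Fin D → ℤ} (hz : z ∈ boxZ N q) :
    ‖termPhi N M Lc q l' l y' (qv q z)‖
      ≤ (if z = 0 then (π ^ 2 / 8 + π ^ 4 / 32) / momSq q else 0) + (1 + (Lc : ℝ)) / 8 * ∏ i, mP Lc (z i) := by
  have hN : 0 < N := Nat.pos_of_ne_zero (NeZero.ne N)
  have hM : 0 < M := Nat.pos_of_ne_zero (NeZero.ne M)
  have hLc : 0 < Lc := Nat.pos_of_ne_zero (NeZero.ne Lc)
  have hLcr : (0 : ℝ) < Lc := by exact_mod_cast hLc
  have hNMr : (N : ℝ) = M * Lc := by exact_mod_cast hNM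
  have hπ := Real.pi_pos
  have hQ : ∀ i, |qv q z i| ≤ π * N := abs_qv_le_of_mem_boxZ hq hz
  obtain ⟨hS, hSinv⟩ := symN_label_bounds hq hq0 hz
  have hmQ : 0 < momSq (qv q z) := momSq_qv_pos hq hq0 z
  have hP : ‖∏ i, pairP N M (qv q z i)‖ ≤ ∏ i, mP Lc (z i) := norm_prod_pairP_le hN hM hLc hNMr hq hQ
  have hPl : ‖pairP N M (qv q z l)‖ ≤ 1 := norm_pairP_le_one hN hM _
  have hPm := prod_mP_nonneg Lc z
  refine (norm_termPhi_le_parts q l' l y' hS).trans ?_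
  by_cases hz0 : z = 0
  · subst hz0
    rw [if_pos rfl]
    have hq' : qv q (0 : Fin D → ℤ) = q := qv_zero q
    rw [hq'] at hSinv hS hmQ hPl hP ⊢
    rw [prod_mP_zero] at hP ⊢
    have hm := hmQ
    have hsq : 0 < Real.sqrt (momSq q) := Real.sqrt_pos.2 hm
    have hE : ‖eM Lc (q l)‖ ≤ Real.sqrt (momSq q) / Lc :=
      (norm_eM_le_abs hLc (q l)).trans (div_le_div_of_nonneg_right (SymbolProjector.abs_apply_le_sqrt_momSq q l) hLcr.le)
    have hd : ‖dhat (ofRealVec q) l'‖ ≤ Real.sqrt (momSq q) := CapacitanceScalarDictionary.norm_dhat_ofRealVec_le_sqrt q l'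
    have hinv2 : (symN N q)⁻¹ ^ 2 ≤ (π ^ 2 / 4 * (momSq q)⁻¹) ^ 2 := pow_le_pow_left₀ (inv_nonneg.2 hS.le) hSinv 2
    have hδ : ‖pairP N M (q l)‖ * (symN N q)⁻¹ / 2 ≤ π ^ 2 / 8 / momSq q := by
      calc ‖pairP N M (q l)‖ * (symN N q)⁻¹ / 2 ≤ 1 * (π ^ 2 / 4 * (momSq q)⁻¹) / 2 := by gcongr
        _ = π ^ 2 / 8 / momSq q := by field_simp; ring
    have hproj : (Lc : ℝ) * ‖dhat (ofRealVec q) l'‖ * ‖eM Lc (q l)‖ * (symN N q)⁻¹ ^ 2 / 2 ≤ π ^ 4 / 32 / momSq q := by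
      calc (Lc : ℝ) * ‖dhat (ofRealVec q) l'‖ * ‖eM Lc (q l)‖ * (symN N q)⁻¹ ^ 2 / 2
          ≤ (Lc : ℝ) * Real.sqrt (momSq q) * (Real.sqrt (momSq q) / Lc) * (π ^ 2 / 4 * (momSq q)⁻¹) ^ 2 / 2 := by gcongr
        _ = (Real.sqrt (momSq q) * Real.sqrt (momSq q)) * (π ^ 4 / 32) / momSq q ^ 2 := by field_simp; ring
        _ = π ^ 4 / 32 / momSq q := by rw [Real.mul_self_sqrt hm.le]; field_simp
    calc ‖∏ i, pairP N M (q i)‖ * (‖pairP N M (q l)‖ * (symN N q)⁻¹ / 2 +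
          (Lc : ℝ) * ‖dhat (ofRealVec q) l'‖ * ‖eM Lc (q l)‖ * (symN N q)⁻¹ ^ 2 / 2)
        ≤ 1 * (π ^ 2 / 8 / momSq q + π ^ 4 / 32 / momSq q) := by
          refine mul_le_mul hP (add_le_add hδ hproj) (by positivity) zero_le_one
      _ = (π ^ 2 / 8 + π ^ 4 / 32) / momSq q := by ring
      _ ≤ (π ^ 2 / 8 + π ^ 4 / 32) / momSq q + (1 + (Lc : ℝ)) / 8 * 1 := by
          have : 0 ≤ (1 + (Lc : ℝ)) / 8 * 1 := by positivity
          linarith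
  · rw [if_neg hz0, zero_add]
    have hE : ‖eM Lc (qv q z l)‖ ≤ 2 := norm_eM_le_two Lc _
    have hd : ‖dhat (ofRealVec q) l'‖ ≤ 2 := by
      rw [SymbolTaylor.norm_dhat_ofRealVec]
      have := Real.abs_sin_le_one (q l' / 2)
      linarith
    have hq4 : (symN N (qv q z))⁻¹ ≤ 1 / 4 := inv_symN_le_quarter hq hq0 hz hz0
    have hinv2 : (symN N (qv q z))⁻¹ ^ 2 ≤ (1 / 4) ^ 2 := pow_le_pow_left₀ (inv_nonneg.2 hS.le) hq4 2
    have hδ : ‖pairP N M (qv q z l)‖ * (symN N (qv q z))⁻¹ / 2 ≤ 1 / 8 := by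
      calc ‖pairP N M (qv q z l)‖ * (symN N (qv q z))⁻¹ / 2 ≤ 1 * (1 / 4) / 2 := by gcongr
        _ = 1 / 8 := by norm_num
    have hproj : (Lc : ℝ) * ‖dhat (ofRealVec q) l'‖ * ‖eM Lc (qv q z l)‖ * (symN N (qv q z))⁻¹ ^ 2 / 2 ≤ (Lc : ℝ) / 8 := by
      calc (Lc : ℝ) * ‖dhat (ofRealVec q) l'‖ * ‖eM Lc (qv q z l)‖ * (symN N (qv q z))⁻¹ ^ 2 / 2
          ≤ (Lc : ℝ) * 2 * 2 * (1 / 4) ^ 2 / 2 := by gcongr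
        _ = (Lc : ℝ) / 8 := by ring
    calc ‖∏ i, pairP N M (qv q z i)‖ * (‖pairP N M (qv q z l)‖ * (symN N (qv q z))⁻¹ / 2 +
          (Lc : ℝ) * ‖dhat (ofRealVec q) l'‖ * ‖eM Lc (qv q z l)‖ * (symN N (qv q z))⁻¹ ^ 2 / 2)
        ≤ (∏ i, mP Lc (z i)) * (1 / 8 + (Lc : ℝ) / 8) := mul_le_mul hP (add_le_add hδ hproj) (by positivity) hPm
      _ = (1 + (Lc : ℝ)) / 8 * ∏ i, mP Lc (z i) := by ring

end Labels

/-! ## §2 The `N`-uniform bounds of the source-side sums -/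

section Sums

variable {N M Lc : ℕ} [NeZero N] [NeZero M] [NeZero Lc]

/-- [folklore] A sum over the alias box of `[z = 0]·A` is at most `A` (`A ≥ 0`). -/
theorem sum_boxZ_ite_le (q : Fin D → ℝ) {A : ℝ} (hA : 0 ≤ A) :
    ∑ z ∈ boxZ N q, (if z = 0 then A else 0) ≤ A := by
  rw [Finset.sum_ite_eq' (boxZ N q) (0 : Fin D → ℤ) (fun _ => A)]
  split_ifs
  · exact le_rfl
  · exact hA

/-- **`N`-UNIFORM BOUND OF `S_c`** (unit `N³`; the `m = 0` pole `N³/|q|³` displayed, the nonzero aliases `p`-free):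
`‖srcC N p (fhatF N M p l y′)‖ ≤ N³ · ((π⁴/16)/(|q|²·|q|) + (Lc/8)·(1 + 4Lc)^D)` for `p = ofRealVec q`, `q ∈ [−π,π]^D ∖ {0}`, `N = M·Lc`.
[folklore; our proof] -/
theorem norm_srcC_fhatF_le (hNM : N = M * Lc) {q : Fin D → ℝ} (hq : ∀ i, |q i| ≤ π) (hq0 : q ≠ 0) (l : Fin D) (y' : Fin D → ℤ) :
    ‖srcC N (ofRealVec q) (fhatF N M (ofRealVec q) l y')‖
      ≤ (N : ℝ) ^ 3 * (π ^ 4 / 16 / (momSq q * Real.sqrt (momSq q)) + (Lc : ℝ) / 8 * (1 + 4 * (Lc : ℝ)) ^ D) := by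
  have hm : 0 < momSq q := by
    have h := momSq_qv_pos hq hq0 0; rwa [qv_zero] at h
  have hsq : 0 < Real.sqrt (momSq q) := Real.sqrt_pos.2 hm
  rw [srcC_fhatF_eq hNM hq hq0 l y', norm_mul, norm_pow, Complex.norm_natCast]
  refine mul_le_mul_of_nonneg_left ?_ (by positivity)
  calc ‖∑ z ∈ boxZ N q, termC N M Lc l y' (qv q z)‖
      ≤ ∑ z ∈ boxZ N q, ‖termC N M Lc l y' (qv q z)‖ := norm_sum_le _ _
    _ ≤ ∑ z ∈ boxZ N q, ((if z = 0 then π ^ 4 / 16 / (momSq q * Real.sqrt (momSq q)) else 0) + (Lc : ℝ) / 8 * ∏ i, mP Lc (z i)) :=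
        Finset.sum_le_sum fun z hz => norm_termC_le hNM hq hq0 l y' hz
    _ = (∑ z ∈ boxZ N q, (if z = 0 then π ^ 4 / 16 / (momSq q * Real.sqrt (momSq q)) else 0))
          + (Lc : ℝ) / 8 * ∑ z ∈ boxZ N q, ∏ i, mP Lc (z i) := by rw [Finset.sum_add_distrib, Finset.mul_sum]
    _ ≤ π ^ 4 / 16 / (momSq q * Real.sqrt (momSq q)) + (Lc : ℝ) / 8 * (1 + 4 * (Lc : ℝ)) ^ D :=
        add_le_add (sum_boxZ_ite_le q (by positivity)) (mul_le_mul_of_nonneg_left (sum_boxZ_prod_mP_le Lc q) (by positivity))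

/-- **`N`-UNIFORM BOUND OF `S_φ`** (unit `N³`; the `m = 0` pole `N³/|q|²` displayed, the nonzero aliases `p`-free):
`‖srcPhi N p (fhatF N M p l y′) 0 l′‖ ≤ N³ · ((π²/8 + π⁴/32)/|q|² + ((1 + Lc)/8)·(1 + 4Lc)^D)` for `p = ofRealVec q`, `q ∈ [−π,π]^D ∖ {0}`,
`N = M·Lc`.  [folklore; our proof] -/
theorem norm_srcPhi_fhatF_le (hNM : N = M * Lc) {q : Fin D → ℝ} (hq : ∀ i, |q i| ≤ π) (hq0 : q ≠ 0) (l' l : Fin D) (y' : Fin D → ℤ) :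
    ‖srcPhi N (ofRealVec q) (fhatF N M (ofRealVec q) l y') 0 l'‖
      ≤ (N : ℝ) ^ 3 * ((π ^ 2 / 8 + π ^ 4 / 32) / momSq q + (1 + (Lc : ℝ)) / 8 * (1 + 4 * (Lc : ℝ)) ^ D) := by
  have hm : 0 < momSq q := by
    have h := momSq_qv_pos hq hq0 0; rwa [qv_zero] at h
  have hπ := Real.pi_pos
  rw [srcPhi_fhatF_eq hNM hq hq0 l' l y', norm_mul, norm_pow, Complex.norm_natCast]
  refine mul_le_mul_of_nonneg_left ?_ (by positivity)
  calc ‖∑ z ∈ boxZ N q, termPhi N M Lc q l' l y' (qv q z)‖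
      ≤ ∑ z ∈ boxZ N q, ‖termPhi N M Lc q l' l y' (qv q z)‖ := norm_sum_le _ _
    _ ≤ ∑ z ∈ boxZ N q, ((if z = 0 then (π ^ 2 / 8 + π ^ 4 / 32) / momSq q else 0) + (1 + (Lc : ℝ)) / 8 * ∏ i, mP Lc (z i)) :=
        Finset.sum_le_sum fun z hz => norm_termPhi_le hNM hq hq0 l' l y' hz
    _ = (∑ z ∈ boxZ N q, (if z = 0 then (π ^ 2 / 8 + π ^ 4 / 32) / momSq q else 0))
          + (1 + (Lc : ℝ)) / 8 * ∑ z ∈ boxZ N q, ∏ i, mP Lc (z i) := by rw [Finset.sum_add_distrib, Finset.mul_sum]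
    _ ≤ (π ^ 2 / 8 + π ^ 4 / 32) / momSq q + (1 + (Lc : ℝ)) / 8 * (1 + 4 * (Lc : ℝ)) ^ D :=
        add_le_add (sum_boxZ_ite_le q (by positivity)) (mul_le_mul_of_nonneg_left (sum_boxZ_prod_mP_le Lc q) (by positivity))

end Sums

end Summit.QuantumFields.BalabanUV.Beta.GAN24.SourceSideBound

end
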